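import Literature.NumberTheory.Transcendental.KZLogCalculusProofs
import Literature.NumberTheory.Transcendental.KZMellinFibres
import Literature.NumberTheory.Transcendental.KZDominatedFamilyRelations
import Summits.KontsevichZagierPeriods.KontsevichZagierPeriods.Theorems.HurwitzMicroSectorsNormalFormPrincipleLevelOneExistsRep

/-!
# `NormalFormPrinciple` (stmt-KontsevichZagierPeriods-3869), line `SketchIdeator1` — leaf `stub_boxRigidity`,
# dimension two off the product type (`FiveZetaTwoOffProduct`): the linear bookkeeping kit

Registered sub-goal `bookkeeping_kit` of the layer `FiveZetaTwoOffProduct` (lead file `…M2`): the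
Kontsevich–Zagier rules (1a)/(1b) bookkeeping used to pass between the open boxes `(0,1)²` and the
band-boxes `{0 < x < 1, 0 ≤ y ≤ 1}` and to absorb integer multiples into integrands.

1. If `R`, `R₀` share a domain on which `R.integrand = n · R₀.integrand`, then `[R] − n [R₀]` is a
   relation: iterated integrand additivity (`KZ.of_sub_of_sub_sum_mem_relations`) with `n` copies of
   `R₀` and a zero representation (`KZ.exists_zeroRep`, `KZ.of_mem_relations_of_eqOn_zero`).
2. An open-box representation with integrand `n · f` and a band-box representation with integrand
   `f` satisfy `[N] − n [T] ∈ relations`: the band-box is the open box plus the two null edges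
   `y ∈ {0, 1}` (`KZ.IntegralRep.of_sub_of_restrict_mem_relations`), then item 1.
3. The band-box representations `[band-box, 1/(1 + x² + xy)]` and `[band-box, 1/(1 − xy)]` exist
   (the first integrand is continuous on the compact cube `[0,1]²`; the second is Beukers' kernel,
   integrable on the open box by `box_integral_one_div_one_sub_mul_two`, plus two null edges).

References: M. Kontsevich, D. Zagier, *Periods* (2001), §1.2, rules (1a), (1b). No new definitions.
-/

noncomputable section

open MeasureTheory Set
open Literature.NumberTheory.Transcendental Literature.NumberTheory.Transcendental.KZ
open Literature.ModelTheory.ExponentialFields (IsSemialgebraic)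

namespace Summit.KontsevichZagierPeriods.HurwitzMicroSectors.NormalFormPrinciple.PiBox.M2

/-! ## (i) Integer multiples inside integrands -/

/-- **Rule (1a), integer multiples.** If `R₀` and `R` have the same domain and
`R.integrand = n · R₀.integrand` on it, then `[R] − n • [R₀] ∈ relations` (iterated integrand
additivity with `n` copies of `R₀` and a zero representation).
[cite: KontsevichZagier2001, §1.2 rule (1)] -/
theorem of_sub_nsmul_of_mem_relations (n : ℕ) (R R₀ : IntegralRep 2) (hd : R₀.domain = R.domain)
    (h : EqOn R.integrand (fun x => (n : ℝ) * R₀.integrand x) R.domain) :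
    of R - n • of R₀ ∈ relations := by
  obtain ⟨Z, hZd, hZi⟩ := exists_zeroRep R.isSemialgebraic_domain
  have h1 : of R - of Z - ∑ _i : Fin n, of R₀ ∈ relations :=
    of_sub_of_sub_sum_mem_relations n R Z (fun _ => R₀) hZd (fun _ => hd) fun x hx => by
      rw [h hx]
      simp [hZi]
  have h2 : of Z ∈ relations := of_mem_relations_of_eqOn_zero Z fun x _ => by simp [hZi]
  have e : of R - n • of R₀ = (of R - of Z - ∑ _i : Fin n, of R₀) + of Z := by
    rw [Finset.sum_const, Finset.card_univ, Fintype.card_fin]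
    abel
  rw [e]
  exact relations.add_mem h1 h2

/-! ## (ii) Open box versus band-box -/

/-- The open box `(0,1)²` lies in the band-box `{0 < x < 1, 0 ≤ y ≤ 1}`. [folklore] -/
theorem box_subset_bandBox :
    {x : Fin 2 → ℝ | ∀ i, x i ∈ Set.Ioo (0:ℝ) 1} ⊆
      KZlog.band {y : Fin 1 → ℝ | 0 < y 0 ∧ y 0 < 1} (fun _ => (0:ℝ)) (fun _ => (1:ℝ)) := by
  intro z hz
  have h0 := hz 0
  have h1 := hz 1
  show (0 < z 0 ∧ z 0 < 1) ∧ 0 ≤ z 1 ∧ z 1 ≤ 1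
  exact ⟨⟨h0.1, h0.2⟩, h1.1.le, h1.2.le⟩

/-- The band-box `{0 < x < 1, 0 ≤ y ≤ 1}` is the open box `(0,1)²` plus the two edges `y ∈ {0, 1}`.
[folklore] -/
theorem bandBox_subset_box_union :
    KZlog.band {y : Fin 1 → ℝ | 0 < y 0 ∧ y 0 < 1} (fun _ => (0:ℝ)) (fun _ => (1:ℝ)) ⊆
      {x : Fin 2 → ℝ | ∀ i, x i ∈ Set.Ioo (0:ℝ) 1} ∪ ({z | z 1 = 0} ∪ {z | z 1 = 1}) := by
  intro z hz
  have h : (0 < z 0 ∧ z 0 < 1) ∧ 0 ≤ z 1 ∧ z 1 ≤ 1 := hz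
  rcases h.2.1.eq_or_lt with h0 | h0
  · exact Or.inr (Or.inl h0.symm)
  rcases h.2.2.lt_or_eq with h1 | h1
  · exact Or.inl (Fin.forall_fin_two.2 ⟨⟨h.1.1, h.1.2⟩, ⟨h0, h1⟩⟩)
  · exact Or.inr (Or.inr h1)

/-- The two edges `y ∈ {0, 1}` are Lebesgue-null, so the band-box minus the open box is null.
[folklore] -/
theorem volume_bandBox_diff_box :
    volume (KZlog.band {y : Fin 1 → ℝ | 0 < y 0 ∧ y 0 < 1} (fun _ => (0:ℝ)) (fun _ => (1:ℝ)) \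
      {x : Fin 2 → ℝ | ∀ i, x i ∈ Set.Ioo (0:ℝ) 1}) = 0 := by
  refine measure_mono_null (fun z hz => ?_)
    (measure_union_null (Measure.pi_hyperplane (fun _ => (volume : Measure ℝ)) 1 0)
      (Measure.pi_hyperplane (fun _ => (volume : Measure ℝ)) 1 1))
  rcases bandBox_subset_box_union hz.1 with h | h
  · exact absurd h hz.2
  · exact h

/-- **Rules (1a) + (1b), open box versus band-box.** If `N = [(0,1)², n · f]` (on the open box) and
`T = [band-box, f]`, then `[N] − n • [T] ∈ relations`: `T` is congruent to its restriction to the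
open box (two null edges, `KZ.IntegralRep.of_sub_of_restrict_mem_relations`), and
`[N] − n • [T|_{(0,1)²}]` is a relation by integrand additivity.
[cite: KontsevichZagier2001, §1.2 rule (1)] -/
theorem of_box_sub_nsmul_of_band_mem_relations (n : ℕ) (f : (Fin 2 → ℝ) → ℝ) (N T : IntegralRep 2)
    (hNd : N.domain = {x | ∀ i, x i ∈ Set.Ioo (0:ℝ) 1})
    (hNi : EqOn N.integrand (fun x => (n : ℝ) * f x) N.domain)
    (hTd : T.domain = KZlog.band {y : Fin 1 → ℝ | 0 < y 0 ∧ y 0 < 1} (fun _ => (0:ℝ)) (fun _ => (1:ℝ)))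
    (hTi : EqOn T.integrand f T.domain) : of N - n • of T ∈ relations := by
  have hEr : N.domain ⊆ T.domain := by
    rw [hNd, hTd]
    exact box_subset_bandBox
  have hnull : volume (T.domain \ N.domain) = 0 := by
    rw [hNd, hTd]
    exact volume_bandBox_diff_box
  have e1 : of T - of (T.restrict N.domain N.isSemialgebraic_domain hEr) ∈ relations :=
    T.of_sub_of_restrict_mem_relations N.isSemialgebraic_domain hEr hnull
  have e2 : of N - n • of (T.restrict N.domain N.isSemialgebraic_domain hEr) ∈ relations :=
    of_sub_nsmul_of_mem_relations n N _ rfl fun x hx => by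
      show N.integrand x = (n : ℝ) * T.integrand x
      rw [hTi (hEr hx)]
      exact hNi hx
  have e : of N - n • of T = (of N - n • of (T.restrict N.domain N.isSemialgebraic_domain hEr)) -
      n • (of T - of (T.restrict N.domain N.isSemialgebraic_domain hEr)) := by
    rw [nsmul_sub]
    abel
  rw [e]
  exact relations.sub_mem e2 (relations.nsmul_mem e1 n)

/-! ## (iii), (iv) The two band-box representations exist -/

/-- The band-box `{0 < x < 1, 0 ≤ y ≤ 1}` is `ℚ`-semialgebraic. [folklore] -/
theorem isSemialgebraic_bandBox :
    IsSemialgebraic ℚ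
      (KZlog.band {y : Fin 1 → ℝ | 0 < y 0 ∧ y 0 < 1} (fun _ => (0:ℝ)) (fun _ => (1:ℝ))) :=
  KZlog.isSemialgebraic_band
    (by simpa using isSemialgebraicFunOn_ratCast isSemialgebraic_unitInterval_fin_one 0)
    (by simpa using isSemialgebraicFunOn_ratCast isSemialgebraic_unitInterval_fin_one 1)

/-- The band-box lies in the closed unit cube `[0,1]²`. [folklore] -/
theorem bandBox_subset_Icc :
    KZlog.band {y : Fin 1 → ℝ | 0 < y 0 ∧ y 0 < 1} (fun _ => (0:ℝ)) (fun _ => (1:ℝ)) ⊆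
      Set.Icc (0 : Fin 2 → ℝ) 1 := by
  intro z hz
  have h : (0 < z 0 ∧ z 0 < 1) ∧ 0 ≤ z 1 ∧ z 1 ≤ 1 := hz
  exact ⟨fun i => by fin_cases i <;> simp [h.1.1.le, h.2.1],
    fun i => by fin_cases i <;> simp [h.1.2.le, h.2.2]⟩

/-- **The representation `[band-box, 1/(1 + x² + xy)]` exists**: its integrand is a quotient of
`ℚ`-polynomials whose denominator is `≥ 1` on the closed cube `[0,1]² ⊇ band-box`, so it is
`ℚ`-semialgebraic on the band-box and continuous on the compact cube, hence absolutely integrable.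
[cite: KontsevichZagier2001, §1.1] -/
theorem exists_bandBoxRep_quad :
    ∃ T : IntegralRep 2,
      T.domain = KZlog.band {y : Fin 1 → ℝ | 0 < y 0 ∧ y 0 < 1} (fun _ => (0:ℝ)) (fun _ => (1:ℝ)) ∧
      T.integrand = fun z => 1 / (1 + z 0 ^ 2 + z 0 * z 1) := by
  have hB := isSemialgebraic_bandBox
  -- the denominator is positive on the closed cube
  have hpos : ∀ z ∈ Set.Icc (0 : Fin 2 → ℝ) 1, 0 < 1 + z 0 ^ 2 + z 0 * z 1 := by
    intro z hz
    have h0 : 0 ≤ z 0 := hz.1 0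
    have h1 : 0 ≤ z 1 := hz.1 1
    positivity
  have hsa : IsSemialgebraicFunOn ℚ
      (KZlog.band {y : Fin 1 → ℝ | 0 < y 0 ∧ y 0 < 1} (fun _ => (0:ℝ)) (fun _ => (1:ℝ)))
      (fun z => 1 / (1 + z 0 ^ 2 + z 0 * z 1)) := by
    refine (isSemialgebraicFunOn_aeval_div_aeval hB 1
      (1 + MvPolynomial.X 0 ^ 2 + MvPolynomial.X 0 * MvPolynomial.X 1) fun x hx => ?_).congr
      fun x _ => by simp
    simp only [map_add, map_mul, map_pow, map_one, MvPolynomial.aeval_X]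
    exact (hpos x (bandBox_subset_Icc hx)).ne'
  have hcont : ContinuousOn (fun z : Fin 2 → ℝ => 1 / (1 + z 0 ^ 2 + z 0 * z 1))
      (Set.Icc (0 : Fin 2 → ℝ) 1) :=
    continuousOn_const.div (by fun_prop) fun z hz => (hpos z hz).ne'
  have hint : IntegrableOn (fun z : Fin 2 → ℝ => 1 / (1 + z 0 ^ 2 + z 0 * z 1))
      (KZlog.band {y : Fin 1 → ℝ | 0 < y 0 ∧ y 0 < 1} (fun _ => (0:ℝ)) (fun _ => (1:ℝ))) :=
    (hcont.integrableOn_compact isCompact_Icc).mono_set bandBox_subset_Icc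
  exact ⟨⟨_, _, hB, hsa, hint⟩, rfl, rfl⟩

/-- **The representation `[band-box, 1/(1 − xy)]` exists** (the band-box form of Beukers' double
integral for `ζ(2)`): the denominator is positive on the band-box (`0 < x < 1`, `0 ≤ y ≤ 1`), and the
kernel is integrable on the open box (`box_integral_one_div_one_sub_mul_two`), which differs from the
band-box by two null edges. [cite: KontsevichZagier2001, §1.1] -/
theorem exists_bandBoxRep_zeta :
    ∃ Z : IntegralRep 2,
      Z.domain = KZlog.band {y : Fin 1 → ℝ | 0 < y 0 ∧ y 0 < 1} (fun _ => (0:ℝ)) (fun _ => (1:ℝ)) ∧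
      Z.integrand = fun z => 1 / (1 - z 0 * z 1) := by
  have hB := isSemialgebraic_bandBox
  have hsa : IsSemialgebraicFunOn ℚ
      (KZlog.band {y : Fin 1 → ℝ | 0 < y 0 ∧ y 0 < 1} (fun _ => (0:ℝ)) (fun _ => (1:ℝ)))
      (fun z => 1 / (1 - z 0 * z 1)) := by
    refine (isSemialgebraicFunOn_aeval_div_aeval hB 1 (1 - MvPolynomial.X 0 * MvPolynomial.X 1)
      fun x hx => ?_).congr fun x _ => by simp
    have h : (0 < x 0 ∧ x 0 < 1) ∧ 0 ≤ x 1 ∧ x 1 ≤ 1 := hx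
    simp only [map_sub, map_mul, map_one, MvPolynomial.aeval_X]
    have h01 : x 0 * x 1 ≤ x 0 * 1 := mul_le_mul_of_nonneg_left h.2.2 h.1.1.le
    exact (show (0:ℝ) < 1 - x 0 * x 1 by linarith [h.1.2]).ne'
  have hint : IntegrableOn (fun z : Fin 2 → ℝ => 1 / (1 - z 0 * z 1))
      (KZlog.band {y : Fin 1 → ℝ | 0 < y 0 ∧ y 0 < 1} (fun _ => (0:ℝ)) (fun _ => (1:ℝ))) :=
    (box_integral_one_div_one_sub_mul_two.1.union ((IntegrableOn.of_measure_zero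
      (Measure.pi_hyperplane (fun _ => (volume : Measure ℝ)) 1 0)).union
      (IntegrableOn.of_measure_zero
        (Measure.pi_hyperplane (fun _ => (volume : Measure ℝ)) 1 1)))).mono_set
      bandBox_subset_box_union
  exact ⟨⟨_, _, hB, hsa, hint⟩, rfl, rfl⟩

/-! ## The kit -/

/-- **Stub B (linear bookkeeping kit, rules 1a + 1b)** of the layer `FiveZetaTwoOffProduct`:
(i) integer multiples inside integrands; (ii) an open box with integrand `n • f` versus `n` copies of
the band-box with integrand `f` (two null edges); (iii), (iv) existence of the two band-box
representations `[band-box, 1/(1 + x² + xy)]` and `[band-box, 1/(1 − xy)]` of the chain.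
[cite: KontsevichZagier2001, §1.2 rule (1)] -/
theorem bookkeeping_kit :
    (∀ (n : ℕ) (R R₀ : IntegralRep 2), R₀.domain = R.domain →
      EqOn R.integrand (fun x => (n : ℝ) * R₀.integrand x) R.domain → of R - n • of R₀ ∈ relations) ∧
    (∀ (n : ℕ) (f : (Fin 2 → ℝ) → ℝ) (N T : IntegralRep 2),
      N.domain = {x | ∀ i, x i ∈ Set.Ioo (0:ℝ) 1} →
      EqOn N.integrand (fun x => (n : ℝ) * f x) N.domain →
      T.domain = KZlog.band {y : Fin 1 → ℝ | 0 < y 0 ∧ y 0 < 1} (fun _ => (0:ℝ)) (fun _ => (1:ℝ)) →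
      EqOn T.integrand f T.domain → of N - n • of T ∈ relations) ∧
    (∃ T : IntegralRep 2,
      T.domain = KZlog.band {y : Fin 1 → ℝ | 0 < y 0 ∧ y 0 < 1} (fun _ => (0:ℝ)) (fun _ => (1:ℝ)) ∧
      T.integrand = fun z => 1 / (1 + z 0 ^ 2 + z 0 * z 1)) ∧
    (∃ Z : IntegralRep 2,
      Z.domain = KZlog.band {y : Fin 1 → ℝ | 0 < y 0 ∧ y 0 < 1} (fun _ => (0:ℝ)) (fun _ => (1:ℝ)) ∧
      Z.integrand = fun z => 1 / (1 - z 0 * z 1)) := by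
  exact ⟨of_sub_nsmul_of_mem_relations, of_box_sub_nsmul_of_band_mem_relations,
    exists_bandBoxRep_quad, exists_bandBoxRep_zeta⟩

end Summit.KontsevichZagierPeriods.HurwitzMicroSectors.NormalFormPrinciple.PiBox.M2
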